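/-
Origin: expansion seat `planner-pub-hodgecm-pv11-g9-0`, handover REPLACE (DOC-ONLY; tree 6725a4cf = r29 18f17d12 + header); ONE rewrite as r29: `^import Pv11g9\.` -> `import HodgeCM.PerL34.` (x1: PrintedTorusEndState) ; in place; comment-stripped residue md5 db6bf115 identical to r29 source (`HOME/pub-hodgecm-pv11-g9/lean/Pv11g9/PrintedOpEndState.lean`, md5 1d3e6bce, 650 lines);
landed by the gen-8 packager in gate run 30 REPLACES the earlier landed copy of `HodgeCM/PerL34/PrintedOpEndState.lean` (import ^import Pv11g9\.PrintedTorusEndState[ \t]*$→import HodgeCM.PerL34.PrintedTorusEndState ×1).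
-/
/-
Copyright: pub-hodgecm cell, unit pub-hodgecm-pv11-g9 (DAG-NODE PROVER #11, gen 9), node #3. Mathlib + tree only.
Origin / target: `HOME/pub-hodgecm-pv11-g9/lean/Pv11g9/PrintedOpEndState.lean` → `HodgeCM/PerL34/PrintedOpEndState.lean`
(imports this seat's node #1 `Pv11g9.PrintedTorusEndState` — RUN 29 queue, tree name `HodgeCM.PerL34.PrintedTorusEndState`,
ONE rewrite `^import Pv11g9\.` ↦ `import HodgeCM.PerL34.` — and the TREE module `HodgeCM.PerL34.S4Strength` (pv08-g3)).
-/
import Summits.HodgeConjecture.HodgeCM.PerL34.PrintedTorusEndState_2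
import Summits.HodgeConjecture.HodgeCM.PerL34.S4Strength_2

/-!
# N29 on the END STATE from OPERATOR-SIDE printed analytic data: no structure on `𝒮^κ` is asked for

PerL v5 (tex blob d912a121, LEMMAS.md §0), verbatim.  l. 343–344: "the $K$-finite (Fock) vectors used so far are dense,
and $\Phi\mapsto\theta_\Phi$ is continuous from $\cS$ to $C([G_U]\times[\U(W)])$ (uniform norm)."  ll. 356–358: "Let
$\mathcal P\subset\cS$ be the subspace of functions which are Fock polynomials (times the Gaussian) at the archimedean
places; it is dense in $\cS$ … and $\mathrm{pr}_\kappa(\mathcal P)$ is dense in $\cS^\kappa$."  ll. 380–381: "For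
$\Phi\in\cS$ let $\mathcal T_\Phi\colon L^2([\U(W)])\to L^2([G_U])$, $(\mathcal T_\Phi v)(g):=\int_{[\U(W)]}\theta_\Phi(g,h)
v(h)\,dh$. As $\theta_\Phi$ is continuous on the compact space $[G_U]\times[\U(W)]$, $\mathcal T_\Phi$ is Hilbert--Schmidt,
hence bounded".  Lemma 4.1(c), ll. 514–515: "Restricting to pure tensors and to the archimedean factor at $b$, we get a
non-zero $\mathfrak u(W_b)$-invariant pairing".

STATE OF THE LANE (RUN 29 queue, this seat's nodes #1/#2).  `PrintedTorusEndState.Open_occ_of_printedCores` discharges the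
OPEN input `occ` (N29) of the binder-minimal end states from, per good context and pair, a `PrintedCore12/34`: a kind map,
scalings, and a TWENTY-field `ArchC.ModelAnalyticSide` over the end-state core `T∘.core V c`.  Four of those twenty fields
— `instSKacg`, `instSKmod` (an additive-group and a ℂ-module structure ON THE TYPE `𝒮^κ`) and `TΦc_add`, `TΦc_smul`
(linearity of `Φ ↦ 𝒯_Φ` in them) — plus `ins : … →ₗ[ℂ] SK` and `dense` (density IN `𝒮^κ`) speak about a linear /
topological-vector-space structure of `𝒮^κ`; on the present end state `SK V c = ↥(C.wm V c).SK` is a bare subtype of the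
topological space `WeilThetaDatum.SX` (Literature interface `HodgeCM/Literature/WeilTheta1964.lean`: `SX` carries a
topology only), so these fields can never be discharged there, whatever the model (GAPS.md `## pub-hodgecm-pv11-g9` A3).

THIS LEAF removes that interface dependence from the END-STATE INPUT, with complete proofs and no new constants:

* §0 `KernelModel.opTCL` — `k ↦ 𝒯_k` is a BOUNDED LINEAR map `C([G_U] × [U(W)], ℂ) →L (L²([U(W)]) →L C([G_U], ℂ))`
  (pv05 `evalT_add_kernel` / `evalT_smul_kernel` / `norm_opTC_le`: ‖𝒯_k‖ ≤ ν([U(W)])^{1/2}‖k‖_∞, l. 381); hence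
  `continuous_opTC_kernel`, `continuous_opTC_θ`: `Φ ↦ 𝒯_Φ` is continuous IN OPERATOR NORM on any kernel model whose
  `Φ ↦ θ_Φ` is sup-norm continuous (l. 343–344) — on the end state: `AdelicTorusCore.continuous_TΦc` (§3).
* §1 `ArchC.pure_detect_of_opDense` — the inference field `pure_detect` of pv06's `ArchCDatum` (if `𝒯_Φ(v)(g) ≠ 0` then
  `𝒯_{φ⊗Φ_f}(v)(g) ≠ 0` for some pure tensor) from OPERATOR-SIDE DENSITY alone: `𝒯_Φ` lies in the operator-norm closure of
  the ℂ-span of the `𝒯_{ins f φ}` (KERNEL: the kernel of the bounded functional `A ↦ (A v)(g)` on `H →L[ℂ] C([G_U])` is a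
  closed subspace).  `ArchC.opDense_of_dense` — conversely-directed bookkeeping: density in `𝒮^κ` + linearity + operator-norm
  continuity of `Φ ↦ 𝒯_Φ` give operator-side density (image of a dense span under a continuous linear map).
* §2 `ArchC.OpAnalyticSide C P RP kind lam hlam vac ιT` — node #1's `ModelAnalyticSide` with the SIX `𝒮^κ`-structure
  fields {`instSKacg`, `instSKmod`, `TΦc_add`, `TΦc_smul`, `ins` (linear), `dense`} REPLACED by FOUR operator-side ones
  {`ins : FinIdx → F → SK` (a bare map), `ins_add`, `ins_smul` (linearity of `φ ↦ 𝒯_{φ⊗Φ_f}` as identities of OPERATORS —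
  exactly the field shape of pv06's `ArchCDatum` / pv08-g3's `ArchCCore`), `op_dense`}: EIGHTEEN fields, none of which
  mentions an algebraic or topological structure of `𝒮^κ`, the torus datum, the points, N21 or `cont`.  `toCore` builds
  pv08-g3's D-free chart `ArchCCore C P` for the printed torus (`Tg`, `F`, `X`, `ωT`, `φ₀` := the printed places', `w :=
  printPlacesW`, `gen` := pv12-g2/g4 `gen_format_of_mem_span`, `φ₀_eigen` := `ωT_φ₀` + `printPlacesW_loc`, `inf_invariance`
  := pv05/pv06 `inf_invariance_of_oneParam` from N21, `pure_detect` := §1) — so `eigen_of_detected` (pv08-g3) applies;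
  `ModelAnalyticSide.toOp` — node #1's record PLUS operator-norm continuity of `Φ ↦ 𝒯_Φ` gives this one (so on the end
  state the new input is IMPLIED BY the old one, §3 `OpPrintedCore12.ofPrinted`).
* §3 ON THE END STATE `T∘ := ThetaModel.ofRegCarrier (C.rtc R12 R34) hA`: `OpPrintedCore12/34` (kind map, scalings, an
  `OpAnalyticSide` over `T∘.core V c` at the canonical points and chart), their `H_occ` (N21 := node #2 `invariance`, the
  occurrence := node #1 `t12_/t34_wOccurs_of_printedEigenvector`), **`Open_occ_of_opPrintedCores : … → T∘.Open_occ`**,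
  `N29_occ_of_opPrintedCores`; §4 the same on prl1-g5's `C₀.thetaModel h d12 d34`; §5 the binder-minimal END STATES
  `Assembly.perL_ofSignRecipe₀_opPrintedCores : … → U.PerL` (+ `realisationExists…`, `COR_CM…`).

HONEST LABEL.  REDUCTION of the end-state input `occ`: per good context and pair, 4 + 18 fields instead of 4 + 20, and —
the point — NO field any more presupposes a vector-space or topological-vector-space structure on `𝒮^κ`; every remaining
field is a statement about the model's `ω`, `𝒯`, `R`, `σ̂_i`, the printed places and the canonical chart, each print-shaped
([SETUP D4/D5/D7]) and dischargeable model by model.  Nothing of N29's archimedean content is proved here: the eighteen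
fields are exactly that content.  Asserts nothing: no new constants, no `axiom`, complete proofs.
-/

set_option autoImplicit false

noncomputable section

open MeasureTheory

namespace HodgeCM

/-! ## §0  `k ↦ 𝒯_k` is bounded linear; `Φ ↦ 𝒯_Φ` is operator-norm continuous on a kernel model -/

namespace KernelModel

open HodgeCM.PerL34 HodgeCM.PerL34.KernelOperator HodgeCM.PerL34.QuotientSmoothing

variable (QU Q : QuotientModel)

/-- **`k ↦ 𝒯_k` as a bounded linear map** `C([G_U] × [U(W)], ℂ) →L[ℂ] (L²([U(W)], ν) →L[ℂ] C([G_U], ℂ))`: linear in the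
kernel (pv05 `evalT_add_kernel`, `evalT_smul_kernel`) and bounded by `ν([U(W)])^{1/2}‖k‖_∞` (pv05 `norm_opTC_le`; tex l. 381
"Hilbert--Schmidt, hence bounded"). -/
def opTCL : C((QU.G ⧸ QU.Γ) × (Q.G ⧸ Q.Γ), ℂ) →L[ℂ] (Lp ℂ 2 Q.ν →L[ℂ] C(QU.G ⧸ QU.Γ, ℂ)) :=
  LinearMap.mkContinuous
    { toFun := fun k => opTC k Q.ν
      map_add' := fun k₁ k₂ => by
        ext v ξ
        simp [evalT_add_kernel]
      map_smul' := fun a k => by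
        ext v ξ
        simp [evalT_smul_kernel] }
    ((measureUnivNNReal Q.ν : ℝ) ^ (2 : ℝ)⁻¹) (fun k => norm_opTC_le k Q.ν)

/-- (Ported verbatim from the HodgeCMPerL package; no docstring in the source.) -/
@[simp] theorem opTCL_apply (k : C((QU.G ⧸ QU.Γ) × (Q.G ⧸ Q.Γ), ℂ)) : opTCL QU Q k = opTC k Q.ν := rfl

/-- `k ↦ 𝒯_k` is continuous for the operator norm. -/
theorem continuous_opTC_kernel : Continuous fun k : C((QU.G ⧸ QU.Γ) × (Q.G ⧸ Q.Γ), ℂ) => opTC k Q.ν :=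
  (opTCL QU Q).continuous

variable {SK : Type} [TopologicalSpace SK] (θ : SK → C((QU.G ⧸ QU.Γ) × (Q.G ⧸ Q.Γ), ℂ))

/-- **`Φ ↦ 𝒯_Φ` is continuous IN OPERATOR NORM** on a kernel model whose `Φ ↦ θ_Φ` is sup-norm continuous (tex l. 343–344;
`WeilThetaModel.θ_cont`). -/
theorem continuous_opTC_θ (hθc : Continuous θ) : Continuous fun Φ : SK => opTC (θ Φ) Q.ν :=
  (continuous_opTC_kernel QU Q).comp hθc

end KernelModel

/-! ## §1  `pure_detect` from operator-side density; operator-side density from `𝒮^κ`-side density -/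

namespace PerL34
namespace ArchC

open HodgeCM.Prior.Perl34File HodgeCM.Prior.Perl34File.Perl34
open HodgeCM.PerL34.Fock HodgeCM.PerL34.Fock.PrintDict

section Op

variable {H HG CG G SK SigIdx SigIdxG : Type*}
variable [NormedAddCommGroup H] [InnerProductSpace ℂ H] [CompleteSpace H]
variable [NormedAddCommGroup HG] [InnerProductSpace ℂ HG] [CompleteSpace HG]
variable [NormedAddCommGroup CG] [NormedSpace ℂ CG]
variable [Group G] [TopologicalSpace G] [TopologicalSpace SK]

/-- **`pure_detect` (pv06 `ArchCDatum.pure_detect`, field shape) from OPERATOR-SIDE DENSITY (KERNEL).**  If every `𝒯_Φ`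
lies in the operator-norm closure of the ℂ-span of the operators `𝒯_{ins f φ}` of the pure tensors, then `𝒯_Φ(v)(g) ≠ 0`
forces `𝒯_{ins f φ}(v)(g) ≠ 0` for some pure tensor: the bounded functional `A ↦ (A v)(g)` on `H →L[ℂ] C([G_U])` has a
closed kernel.  Print: l. 514–515 "Restricting to pure tensors", justified by ll. 343–344, 356–358, 380–381 (quoted in the
module docstring).  No structure on `𝒮^κ` is used. -/
theorem pure_detect_of_opDense {C : IsolationCore H HG CG G SK SigIdx SigIdxG} {P : C4a.PointedCore C}
    {F FinIdx : Type*} (ins : FinIdx → F → SK)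
    (op_dense : ∀ Φ : SK, C.TΦc Φ ∈ (Submodule.span ℂ
      (Set.range fun q : FinIdx × F => C.TΦc (ins q.1 q.2))).topologicalClosure) :
    ∀ (Φ : SK) (p : P.Pt) (v : H), P.evalPt p (C.TΦc Φ v) ≠ 0 →
      ∃ (f : FinIdx) (φ : F), P.evalPt p (C.TΦc (ins f φ) v) ≠ 0 := by
  intro Φ p v hΦ
  by_contra hno
  push Not at hno
  let Lv : (H →L[ℂ] CG) →L[ℂ] ℂ := (P.evalPt p).comp (ContinuousLinearMap.apply ℂ CG v)
  have hLv : ∀ A : H →L[ℂ] CG, Lv A = P.evalPt p (A v) := fun A => rfl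
  have hle : Submodule.span ℂ (Set.range fun q : FinIdx × F => C.TΦc (ins q.1 q.2))
      ≤ LinearMap.ker (Lv : (H →L[ℂ] CG) →ₗ[ℂ] ℂ) := by
    refine Submodule.span_le.mpr ?_
    rintro _ ⟨q, rfl⟩
    rw [SetLike.mem_coe, LinearMap.mem_ker, ContinuousLinearMap.coe_coe, hLv]
    exact hno q.1 q.2
  have hcl := (Submodule.span ℂ (Set.range fun q : FinIdx × F => C.TΦc (ins q.1 q.2))).topologicalClosure_minimal
    hle Lv.isClosed_ker (op_dense Φ)
  rw [LinearMap.mem_ker, ContinuousLinearMap.coe_coe, hLv] at hcl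
  exact hΦ hcl

/-- **Operator-side density from `𝒮^κ`-side density.**  If `𝒮^κ` IS a ℂ-vector space on which `Φ ↦ 𝒯_Φ` is linear
(`TΦc_add`, `TΦc_smul`) and continuous IN OPERATOR NORM (`hTc`; on a kernel model §0 `continuous_opTC_θ`), and the pure
tensors span a dense subspace of `𝒮^κ` (`dense`), then every `𝒯_Φ` lies in the operator-norm closure of the span of the
`𝒯_{ins f φ}` (the image of a dense span under a continuous linear map). -/
theorem opDense_of_dense [AddCommGroup SK] [Module ℂ SK] {C : IsolationCore H HG CG G SK SigIdx SigIdxG}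
    (TΦc_add : ∀ Φ Ψ : SK, C.TΦc (Φ + Ψ) = C.TΦc Φ + C.TΦc Ψ)
    (TΦc_smul : ∀ (c : ℂ) (Φ : SK), C.TΦc (c • Φ) = c • C.TΦc Φ)
    (hTc : Continuous fun Φ : SK => C.TΦc Φ)
    {F FinIdx : Type*} (ins : FinIdx → F → SK)
    (dense : Dense (Submodule.span ℂ (Set.range fun q : FinIdx × F => ins q.1 q.2) : Set SK)) :
    ∀ Φ : SK, C.TΦc Φ ∈ (Submodule.span ℂ
      (Set.range fun q : FinIdx × F => C.TΦc (ins q.1 q.2))).topologicalClosure := by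
  intro Φ
  let T : SK →ₗ[ℂ] (H →L[ℂ] CG) := { toFun := C.TΦc, map_add' := TΦc_add, map_smul' := TΦc_smul }
  have hT : ∀ Ψ : SK, T Ψ = C.TΦc Ψ := fun Ψ => rfl
  have hmaps : Set.MapsTo C.TΦc (Submodule.span ℂ (Set.range fun q : FinIdx × F => ins q.1 q.2) : Set SK)
      (Submodule.span ℂ (Set.range fun q : FinIdx × F => C.TΦc (ins q.1 q.2)) : Set (H →L[ℂ] CG)) := by
    intro Ψ hΨ
    have h1 : T Ψ ∈ (Submodule.span ℂ (Set.range fun q : FinIdx × F => ins q.1 q.2)).map T :=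
      Submodule.mem_map_of_mem hΨ
    rw [Submodule.map_span, ← Set.range_comp] at h1
    have h2 : (T ∘ fun q : FinIdx × F => ins q.1 q.2) = fun q : FinIdx × F => C.TΦc (ins q.1 q.2) :=
      funext fun q => hT _
    rw [h2, hT] at h1
    exact h1
  rw [← SetLike.mem_coe, Submodule.topologicalClosure_coe]
  exact map_mem_closure hTc (dense Φ) hmaps

/-! ## §2  The OPERATOR-SIDE printed analytic side and its D-free chart -/

/-- **The operator-side printed analytic side** of a core `C` at points `P`, printed places `(RP, kind, lam, vac)` and a
chart torus `ιT`: node #1's `ModelAnalyticSide` with the six `𝒮^κ`-structure fields (`instSKacg`, `instSKmod`, `TΦc_add`,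
`TΦc_smul`, the linear `ins`, `dense`) REPLACED by four operator-side ones (`ins` a bare map, `ins_add`, `ins_smul`,
`op_dense`).  EIGHTEEN fields; none mentions a structure on `𝒮^κ`, the torus datum, the points' construction, N21 or
`cont`. -/
structure OpAnalyticSide (C : IsolationCore H HG CG G SK SigIdx SigIdxG) (P : C4a.PointedCore C)
    (RP : Type) [Fintype RP] [DecidableEq RP] (kind : RP → PlaceKind) (lam : RP → ℂ)
    (hlam : ∀ b, lam b ≠ 0) (vac : RP → (Circle × Circle →* Circle))
    (ιT : (printPlaces RP kind lam hlam vac).Tg →* G) where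
  /-- [SETUP D4] index of the fixed data at the other places: Φ_f ∈ 𝒮((V₃⊗W)(𝔸_f)). -/
  FinIdx : Type
  /-- [SETUP D4] the pure tensor φ ↦ φ ⊗ Φ_f ∈ 𝒮^κ, φ ∈ 𝓕^κ_∞ = ⊗_b 𝓕^{κ_b}_b (printed places) — a bare map. -/
  ins : FinIdx → (printPlaces RP kind lam hlam vac).F → SK
  /-- [SETUP D4] φ ↦ 𝒯_{φ⊗Φ_f} is additive (as operators L²([U(W)]) → C([G_U])). -/
  ins_add : ∀ (f : FinIdx) (φ ψ : (printPlaces RP kind lam hlam vac).F),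
    C.TΦc (ins f (φ + ψ)) = C.TΦc (ins f φ) + C.TΦc (ins f ψ)
  /-- [SETUP D4] φ ↦ 𝒯_{φ⊗Φ_f} is homogeneous. -/
  ins_smul : ∀ (f : FinIdx) (c : ℂ) (φ : (printPlaces RP kind lam hlam vac).F),
    C.TΦc (ins f (c • φ)) = c • C.TΦc (ins f φ)
  /-- [SETUP D4/D5] operator-side density: `𝒯_Φ` is an operator-norm limit of ℂ-combinations of the `𝒯_{φ⊗Φ_f}`
  (ll. 343–344 + 356–358 + 380–381: pr_κ(𝒫) dense in 𝒮^κ, Φ ↦ θ_Φ sup-norm continuous, ‖𝒯_Φ‖ ≤ vol^{1/2}‖θ_Φ‖_∞). -/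
  op_dense : ∀ Φ : SK, C.TΦc Φ ∈ (Submodule.span ℂ
    (Set.range fun q : FinIdx × (printPlaces RP kind lam hlam vac).F => C.TΦc (ins q.1 q.2))).topologicalClosure
  /-- [SETUP D4] ω(t)(φ ⊗ Φ_f) = (ω_∞(t)φ) ⊗ Φ_f with ω_∞|_T = ⊗_b ω_{W,b}|_{T_b} (printed scalings, PINNED vacuum
  characters). -/
  omg_ins : ∀ (f : FinIdx) (t : (printPlaces RP kind lam hlam vac).Tg) (φ : (printPlaces RP kind lam hlam vac).F),
    C.omg (ιT t) (ins f φ) = ins f ((printPlaces RP kind lam hlam vac).ωT t φ)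
  /-- [SETUP D5] index of a family of REAL directions X_j ∈ 𝔲(W)(L₀⊗ℝ). -/
  ιR : Type
  /-- [SETUP D5] ω_∞(X_j) on 𝓕^κ_∞. -/
  XR : ιR → (printPlaces RP kind lam hlam vac).F →ₗ[ℂ] (printPlaces RP kind lam hlam vac).F
  /-- [SETUP D4] the one-parameter subgroups e_j(s) = exp(sX_j). -/
  e : ιR → ℝ → G
  /-- [SETUP D4] e_j(0) = 1. -/
  he : ∀ j, e j 0 = 1
  /-- [SETUP D5] every printed slot / ladder operator is a ℂ-combination of the real directions (Folland Prop. (4.49)). -/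
  ladder_span : ∀ k : (printPlaces RP kind lam hlam vac).ιX,
    (printPlaces RP kind lam hlam vac).X k ∈ Submodule.span ℂ (Set.range XR)
  /-- [SETUP D5′, FRÉCHET-SMOOTH VECTOR composed with the bounded linear Φ ↦ 𝒯_Φ(·)(g)] derivative of
  s ↦ 𝒯_{ω(e_j s)(φ⊗Φ_f)}(·)(g) at 0 with VALUE 𝒯_{(X_jφ)⊗Φ_f}(·)(g).  WARRANT (adv2g34-O14 / adv2g35-O14-R): Poulsen 1972
  Prop. 1.2 + Thm. 1.2 p. 93; (D_∞(μ|Mp), Goodman) = (𝒮, Schwartz) by Folland 1989 p. 165 (4.47) + Reed–Simon I App. to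
  §V.3 Lemmas 1–2 / Thm. V.13 pp. 141–143 + Folland Thm. (4.45); Folland (4.45)/(4.49) for the VALUE dω(X_j) only. -/
  hF : ∀ (j : ιR) (f : FinIdx) (φ : (printPlaces RP kind lam hlam vac).F) (p : P.Pt),
    HasDerivAt (fun s : ℝ => C4a.pointFunctional C P (C.omg (e j s) (ins f φ)) p)
      (C4a.pointFunctional C P (ins f (XR j φ)) p) 0
  /-- [SETUP D7] the smooth (Gårding) vectors of σ̂_i (Getz–Hahn Prop. 4.2.3). -/
  Sm : SigIdx → Set H
  /-- [SETUP D7] smooth vectors lie in σ̂_i. -/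
  Sm_sub : ∀ i, Sm i ⊆ (C.hatσ i : Set H)
  /-- [SETUP D7] smooth vectors are dense in σ̂_i. -/
  Sm_dense : ∀ i, (C.hatσ i : Set H) ⊆ closure (Sm i)
  /-- [SETUP D7] the derived action dR(X_j) on smooth vectors (Getz–Hahn Lemma 4.2.2). -/
  YR : ιR → H → H
  /-- [SETUP D7] smooth vectors are stable under dR(X_j). -/
  YR_mem : ∀ (j : ιR) (i : SigIdx), ∀ v ∈ Sm i, YR j v ∈ Sm i
  /-- [SETUP D7] s ↦ R(e_j s)v is differentiable at 0 with derivative dR(X_j)v on smooth vectors. -/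
  hH : ∀ (j : ιR) (i : SigIdx), ∀ v ∈ Sm i, HasDerivAt (fun s : ℝ => C.R (e j s) v) (YR j v) 0

namespace OpAnalyticSide

variable {C : IsolationCore H HG CG G SK SigIdx SigIdxG} {P : C4a.PointedCore C}
variable {RP : Type} [Fintype RP] [DecidableEq RP] {kind : RP → PlaceKind} {lam : RP → ℂ} {hlam : ∀ b, lam b ≠ 0}
  {vac : RP → (Circle × Circle →* Circle)} {ιT : (printPlaces RP kind lam hlam vac).Tg →* G}

/-- **pv08-g3's D-free chart `ArchCCore C P` for the PRINTED torus, from the operator-side data plus N21** (`hinv`, field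
shape of `ArchCCore.invariance`; on the end state node #2's theorem): `Tg`, `F`, `ωT`, `φ₀` := the printed places',
`ιT := ιT`, `w := printPlacesW` (`w_norm` := pv12-g7 `printPlacesW_norm`), `X := XR`, `gen` := pv12-g2/g4
`gen_format_of_mem_span` from `ladder_span`, `φ₀_eigen` := pv12-g2 `ωT_φ₀` + pv12-g7 `printPlacesW_loc`, `pure_detect` := §1
`pure_detect_of_opDense`, `inf_invariance` := pv05/pv06 `inf_invariance_of_oneParam` from `hinv`, `hF`, `hH`. -/
def toCore (A : OpAnalyticSide C P RP kind lam hlam vac ιT)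
    (hinv : ∀ (h : G) (Φ : SK) (v : H), C.TΦc (C.omg h Φ) (C.R h v) = C.TΦc Φ v) : ArchCCore C P where
  F := (printPlaces RP kind lam hlam vac).F
  ιX := A.ιR
  X := A.XR
  Tg := (printPlaces RP kind lam hlam vac).Tg
  ιT := ιT
  w := printPlacesW RP kind lam hlam vac
  w_norm := printPlacesW_norm RP kind lam hlam vac
  ωT := (printPlaces RP kind lam hlam vac).ωT
  FinIdx := A.FinIdx
  ins := A.ins
  φ₀ := (printPlaces RP kind lam hlam vac).φ₀
  Sm := A.Sm
  Y := A.YR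
  ins_add := A.ins_add
  ins_smul := A.ins_smul
  omg_ins := A.omg_ins
  invariance := hinv
  pure_detect := pure_detect_of_opDense A.ins A.op_dense
  Sm_sub := A.Sm_sub
  Sm_dense := A.Sm_dense
  Y_mem := A.YR_mem
  inf_invariance :=
    inf_invariance_of_oneParam hinv A.ins A.Sm (fun j φ => A.XR j φ) A.YR A.e A.he A.hF A.hH
  gen := (printPlaces RP kind lam hlam vac).gen_format_of_mem_span A.XR A.ladder_span
  φ₀_eigen := fun t => by rw [(printPlaces RP kind lam hlam vac).ωT_φ₀, printPlacesW_loc RP kind lam hlam vac]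

/-- Read-back (`rfl`): the chart's torus map IS `ιT`. -/
theorem toCore_ιT (A : OpAnalyticSide C P RP kind lam hlam vac ιT)
    (hinv : ∀ (h : G) (Φ : SK) (v : H), C.TΦc (C.omg h Φ) (C.R h v) = C.TΦc Φ v) :
    (A.toCore hinv).ιT = ιT := rfl

/-- Read-back (`rfl`): the chart's character IS the printed weight. -/
theorem toCore_w (A : OpAnalyticSide C P RP kind lam hlam vac ιT)
    (hinv : ∀ (h : G) (Φ : SK) (v : H), C.TΦc (C.omg h Φ) (C.R h v) = C.TΦc Φ v) :
    (A.toCore hinv).w = printPlacesW RP kind lam hlam vac := rfl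

/-- Read-back (`rfl`): the chart's pure tensors ARE `ins`. -/
theorem toCore_ins (A : OpAnalyticSide C P RP kind lam hlam vac ιT)
    (hinv : ∀ (h : G) (Φ : SK) (v : H), C.TΦc (C.omg h Φ) (C.R h v) = C.TΦc Φ v) :
    (A.toCore hinv).ins = A.ins := rfl

/-- **Detected ⊆ Eigen for the printed torus** (pv08-g3 `ArchCCore.eigen_of_detected` on `toCore`): if `𝒯_Φ|_{σ̂_i} ≠ 0`
then `σ̂_i` contains a non-zero joint eigenvector of `ιT(T_print)` of character `printPlacesW`. -/
theorem eigen_of_detected (A : OpAnalyticSide C P RP kind lam hlam vac ιT)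
    (hinv : ∀ (h : G) (Φ : SK) (v : H), C.TΦc (C.omg h Φ) (C.R h v) = C.TΦc Φ v)
    (Φ : SK) (i : SigIdx) (h : ∃ v ∈ C.hatσ i, C.TΦ Φ v ≠ 0) :
    ∃ y ∈ C.hatσ i, y ≠ 0 ∧ ∀ t : (printPlaces RP kind lam hlam vac).Tg,
      C.R (ιT t) y = printPlacesW RP kind lam hlam vac t • y :=
  (A.toCore hinv).eigen_of_detected Φ i h

/-- **Lemma 4.1(c) in `H_occ` shape for any occurrence predicate `W` that reads printed eigenvectors** (on the end state:
node #1's `t12_/t34_wOccurs_of_printedEigenvector`). -/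
theorem occ_of_wOccurs (A : OpAnalyticSide C P RP kind lam hlam vac ιT)
    (hinv : ∀ (h : G) (Φ : SK) (v : H), C.TΦc (C.omg h Φ) (C.R h v) = C.TΦc Φ v)
    {W : SigIdx → Prop}
    (hW : ∀ i : SigIdx, (∃ y ∈ C.hatσ i, y ≠ 0 ∧ ∀ t : (printPlaces RP kind lam hlam vac).Tg,
      C.R (ιT t) y = printPlacesW RP kind lam hlam vac t • y) → W i) :
    ∀ (Φ : SK) (i : SigIdx), (∃ v ∈ C.hatσ i, C.TΦ Φ v ≠ 0) → W i :=
  fun Φ i h => hW i (A.eigen_of_detected hinv Φ i h)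

/-- pv06's full `ArchCDatum C D P` for any torus datum `D` whose `wOccurs` reads printed eigenvectors (pv08-g3
`ArchCCore.toDatum`). -/
def toDatum (A : OpAnalyticSide C P RP kind lam hlam vac ιT)
    (hinv : ∀ (h : G) (Φ : SK) (v : H), C.TΦc (C.omg h Φ) (C.R h v) = C.TΦc Φ v) (D : TorusData C)
    (hD : ∀ i : SigIdx, (∃ y ∈ C.hatσ i, y ≠ 0 ∧ ∀ t : (printPlaces RP kind lam hlam vac).Tg,
      C.R (ιT t) y = printPlacesW RP kind lam hlam vac t • y) → D.wOccurs i) :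
    ArchCDatum C D P :=
  (A.toCore hinv).toDatum D hD

/-- … hence the S4 leaf `OccLeaf C D` (pv08-g3 `ArchCCore.occLeaf_of_core`). -/
theorem occLeaf (A : OpAnalyticSide C P RP kind lam hlam vac ιT)
    (hinv : ∀ (h : G) (Φ : SK) (v : H), C.TΦc (C.omg h Φ) (C.R h v) = C.TΦc Φ v) (D : TorusData C)
    (hD : ∀ i : SigIdx, (∃ y ∈ C.hatσ i, y ≠ 0 ∧ ∀ t : (printPlaces RP kind lam hlam vac).Tg,
      C.R (ιT t) y = printPlacesW RP kind lam hlam vac t • y) → D.wOccurs i) :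
    OccLeaf C D :=
  (A.toCore hinv).occLeaf_of_core D hD

end OpAnalyticSide

/-- **Node #1's MODEL analytic side plus operator-norm continuity of `Φ ↦ 𝒯_Φ` gives the operator side**: `ins_add`,
`ins_smul` from the linear `ins` and `TΦc_add`/`TΦc_smul` (as in pv12-g4 `FockAnalyticBridge.toArchCDatum`), `op_dense`
from §1 `opDense_of_dense`; the other fourteen fields verbatim. -/
def ModelAnalyticSide.toOp {C : IsolationCore H HG CG G SK SigIdx SigIdxG} {P : C4a.PointedCore C}
    {RP : Type} [Fintype RP] [DecidableEq RP] {kind : RP → PlaceKind} {lam : RP → ℂ} {hlam : ∀ b, lam b ≠ 0}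
    {vac : RP → (Circle × Circle →* Circle)} {ιT : (printPlaces RP kind lam hlam vac).Tg →* G}
    (A : ModelAnalyticSide C P RP kind lam hlam vac ιT) (hTc : Continuous fun Φ : SK => C.TΦc Φ) :
    OpAnalyticSide C P RP kind lam hlam vac ιT :=
  letI : AddCommGroup SK := A.instSKacg
  letI : Module ℂ SK := A.instSKmod
  { FinIdx := A.FinIdx
    ins := fun f φ => A.ins f φ
    ins_add := fun f φ ψ => by
      show C.TΦc (A.ins f (φ + ψ)) = C.TΦc (A.ins f φ) + C.TΦc (A.ins f ψ)
      rw [map_add, A.TΦc_add]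
    ins_smul := fun f c φ => by
      show C.TΦc (A.ins f (c • φ)) = c • C.TΦc (A.ins f φ)
      rw [LinearMap.map_smul, A.TΦc_smul]
    op_dense := opDense_of_dense A.TΦc_add A.TΦc_smul hTc (fun f φ => A.ins f φ) A.dense
    omg_ins := A.omg_ins
    ιR := A.ιR
    XR := A.XR
    e := A.e
    he := A.he
    ladder_span := A.ladder_span
    hF := A.hF
    Sm := A.Sm
    Sm_sub := A.Sm_sub
    Sm_dense := A.Sm_dense
    YR := A.YR
    YR_mem := A.YR_mem
    hH := A.hH }

end Op

end ArchC
end PerL34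

/-! ## §3  On the END STATE: `Open_occ` from operator-side printed cores -/

namespace Universe

namespace AdelicTorusCore

open HodgeCM.PerL34 HodgeCM.PerL34.ArchC HodgeCM.PerL34.Fock HodgeCM.PerL34.Fock.PrintDict
open HodgeCM.Prior.Perl34File HodgeCM.Prior.Perl34File.Perl34
open NumberField NumberField.SeesawArchTorus

variable {U : Universe} {hP : PrintFact_unitaryCompact} (C : U.AdelicTorusCore hP)
  (R12 : ∀ {L : CMField} {ι₁ : L →+* ℂ} (V : HermSpace3 L ι₁) (c : SeesawCtx L), C.Rest12 V c)
  (R34 : ∀ {L : CMField} {ι₁ : L →+* ℂ} (V : HermSpace3 L ι₁) (c : SeesawCtx L), C.Rest34 V c)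
  (hA : (C.rtc R12 R34).Analytic)

section Cont


-- port_pkg: scope closed for this part
end Cont
end AdelicTorusCore
end Universe
end HodgeCM
end
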